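import Summits.BirchSwinnertonDyer.Rank1Residual.X11b.ClassClosureNotRamResidue
import Summits.BirchSwinnertonDyer.Rank1Residual.X11b.RegMultCertificateJoin
import HarnessLib

/-!
# Class X11b = N8 (census cell, seat `census-ctyper-2`, H-7 REG-MULT): ONE REGMULT row as the
# per-pair input `C6` of cc-typer-3's CONGRUENCE transport (p251763) and of the `¬Ram` residue
# theorems (p252284) — SIGN-AWARE, so that a SPLIT cell needs only its modified-height row

HONEST FRAMING (verbatim, cell `b2b-bsdres`, run/shared/lean/b2b/bsd-rank1-residual/): the goal of
the cell is to DELETE the COMBINATION-SHAPED residual classes for ALL analytic-rank `≤ 1` curves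
over `ℚ` — 'full BSD formula for every rank `≤ 1` curve in class C' assembled STRICTLY from
published theorems — so that the rank-`≤ 1` remainder becomes exactly the CONSTRUCTION-SHAPED
classes, which are TYPED (missing-input Props), NOT attempted; this is not 'finishing BSD'.
Research routes; no claim beyond stated classes; census / instrument output = EVIDENCE /
certificate rows (instrumentation tier — booking is referee A's / the director's call), never a
Literature fact; nothing here books anything or changes a label or a RESIDUAL-MAP mark; class X11b
stays CONSTRUCTION-SHAPED; the class-wide statement behind a regulator certificate is Schneider's
conjecture (barrier `Literature/Barriers/BirchSwinnertonDyer/PAdicHeightNondegeneracy`), NEVER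
asserted here.

## Why this file (the kernel side of the census cell's `INSTANCES-t0-C6` join)

cc-typer-3's transport theorem of record `ClassClosure.bsdp_of_goodOrdinaryPartner_of_surj_of_regulatorNonvanishing`
(p251763) and the `¬Ram` residue theorems of p252284 take the pair's Schneider input BUNDLED,
`ClassClosure.RegulatorNonvanishingAt W p` = (`.1` Schneider for every Stein–Wuthrich (4.1) datum
`IsMultCanonical Dh q`) ∧ (`.2` for every modified §4.2 datum `IsSplitMultCanonical Dh Dq`). A
REGMULT-PAIR/v1 row (p251709) certifies EXACTLY ONE height: `RegMult.CertNonsplit` on a non-split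
curve (there one row gives the bundle, `RegMult.regulatorNonvanishingAt_of_cert_of_not_split`),
`RegMult.CertSplit` on a split curve — where the bundle's `.1` quantifies over (4.1)-data no
certificate of record addresses, although the consumers only USE `.2`. The census join
`HOME/b2b-bsdres-census-ctyper2/regmult/INSTANCES-t0-C6.md` (sources: REG-MULT tranche 0 = W5 kit
j123725, 138/138 CERT, two engines; cc-eng-2 `class-closure/N8/CONG-certified-eng2.tsv`
(Kraus–Oesterlé-certified partners); cc-eng-1 obsanat `E2-hypotheses.tsv`; cc-typer-3
`class-closure/O2/TRANSPORT-typer3.md` §3a/§6) sorts the 138 `¬Ram` N8 cells (`p ≥ 5`) as 49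
C6-TRANSPORT · 1 C6-CM-PARTNER (`84960d1@5`, `5Ns`, partner `288a`) · 7 peu ramifié without rational
partner · 81 très ramifié; ALL 50 partner cells are SPLIT at `p`. So a production row instantiates
the SIGN-AWARE theorems below: conclusion from the published named facts (`hEPW hB hJn hJs hHn hHs
hD hKato hGZK hpar`), the typed OPEN inputs where named (`X2.MazurMainConjectureAt`,
`X11a.BaseChangeLowerBoundAt`), the finite per-pair inputs (partner `hgood₁ hord₁ hiso` = C1/C2,
`hsurj` = C3, `hcert₁` = C4, `hm` = C5) and ONE row of the sign's kind (C6: `hcs` iff split, `hcn`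
iff non-split). Theorems only (0 definitions, 0 named facts); every one CONDITIONAL on its binders;
what a certified row is WORTH is the lane's / referee A's decision, not this file's.

References: [EmertonPollackWeston2006] Cor. 5.1.4, Thm. 5.1.3; [BurungaleCastellaSkinner2025] Thm.
1.1.2 (b), Prop. 5.2.1 / (5.3); [SteinWuthrich2013] Thm. 6.1, §4.2 (pp. 15–16, 20); [Disegni2020]
Thm. 1 (§1.2), (∗); [Wuthrich2014] Thm. 3, Cor. 19; [Skinner2016PacificMC] §3.2–3.3 (shape);
[Miller2011LMS] Def. 1.1; [KrausOesterle1992] Prop. 4 (the lane's C2 certificates);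
[Schneider1982] §1 (the conjecture behind C6).
-/

set_option autoImplicit false

noncomputable section

open scoped Classical MatrixGroups ModularForm

open CongruenceSubgroup WeierstrassCurve Literature.NumberTheory.EllipticCurves
  Literature.NumberTheory.EllipticCurves.ModularForms
  Literature.NumberTheory.EllipticCurves.Rank1Residual
  Literature.NumberTheory.EllipticCurves.Rank1Residual.Typed
  Literature.NumberTheory.EllipticCurves.Skinner2016
  Literature.NumberTheory.EllipticCurves.SteinWuthrich2013
  Literature.NumberTheory.EllipticCurves.Wuthrich2014
  Literature.NumberTheory.EllipticCurves.Disegni2020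
  Literature.NumberTheory.EllipticCurves.GreenbergVatsal2000
  Literature.NumberTheory.EllipticCurves.EmertonPollackWeston2006
  Literature.NumberTheory.EllipticCurves.BurungaleCastellaSkinner2025
  Summit.BirchSwinnertonDyer.Rank1Residual.GaloisImage

namespace Summit.BirchSwinnertonDyer.Rank1Residual.X11b

/-! ### §1 Sign-aware transports and residue theorems: the matching Schneider HALF only -/

namespace ClassClosure

section SignAware

variable (W : WeierstrassCurve ℚ) [W.IsElliptic] [W.IsGloballyMinimal] (p : ℕ) [Fact p.Prime]

/-- **CONGRUENCE TRANSPORT, good-ordinary partner, `E` SPLIT at `p ≥ 5` (analytic rank one; (ram)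
NOT required): `BSD(E,p)` from Emerton–Pollack–Weston Cor. 5.1.4 (`hEPW`), Stein–Wuthrich Thm. 6.1
split + the modified §4.2 height (`hJs hHs`), Disegni 2020 Thm. 1 (`hD`, hypothesis (∗) = `hp5` + a
second multiplicative prime `hm`), GZK, modularity, the partner data (`E₁` good ordinary at `p`,
`E₁[p] ≃ E[p]`, `h₁ : GoodOrdinaryCharIdealMuZero W₁ p`) and ONLY the SPLIT Schneider half `hSch`
(Schneider for the modified §4.2 height data).** Same chain as
`bsdp_of_transfer_goodOrdinary_of_regulatorNonvanishing` (p251763), ending in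
`bsdp_of_multCharIdealMuZero_of_split_of_five_le_of_schneider` instead of the bundled form; the
(4.1)-half of `RegulatorNonvanishingAt W p` is not needed on a split curve. CONDITIONAL; nothing booked.
[cite: EmertonPollackWeston2006, Cor. 5.1.4 and Thm. 5.1.3 (arXiv:math/0404484 p. 30)]
[cite: SteinWuthrich2013, Thm. 6.1, §4.2 (p. 16)] [cite: Disegni2020, Thm. 1 (§1.2), hypothesis (∗)]
[cite: Miller2011LMS, Def. 1.1] -/
theorem bsdp_of_transfer_goodOrdinary_of_split_of_schneider
    (hEPW : cor514_transfer_of_goodOrdinary) (hJs : thm61_splitMultiplicative)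
    (hHs : exists_isSplitMultCanonical) (hD : thm1_padicBSD_rankOne_multiplicative)
    (hGZK : rank_eq_analyticRank_of_analyticRank_le_one) (hpar : nonempty_modularParametrizationData)
    (W₁ : WeierstrassCurve ℚ) [W₁.IsElliptic] [W₁.IsGloballyMinimal]
    (hp5 : 5 ≤ p) (hX : ClassX11b W p) (hsplit : W.HasSplitMultiplicativeReductionAtPrime p)
    (hm : ∃ (m : ℕ) (_ : Fact m.Prime), m ≠ p ∧ W.HasMultiplicativeReductionAtPrime m)
    (hgood₁ : W₁.HasGoodReductionAtPrime p) (hord₁ : ¬ (p : ℤ) ∣ W₁.frobeniusTrace p)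
    (hiso : ∃ e : geomTorsion W₁ (p : ℤ) ≃+ geomTorsion W (p : ℤ),
      ∀ (σ : Field.absoluteGaloisGroup ℚ) (P : geomTorsion W₁ (p : ℤ)), e (σ • P) = σ • e P)
    (h₁ : GoodOrdinaryCharIdealMuZero W₁ p)
    (hSch : ∀ (Dq : TateParameterData W p) (Dh : PAdicHeightData W p),
      IsSplitMultCanonical Dh Dq → SchneiderConjecture Dh) : BSDp W p := by
  obtain ⟨e, he⟩ := hiso
  have hirr₁ : W₁.HasIrreducibleModPGaloisRep p :=
    hasIrreducibleModPGaloisRep_of_torsionIso_symm e he hX.2.2.2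
  exact bsdp_of_multCharIdealMuZero_of_split_of_five_le_of_schneider W p hJs hHs hGZK hpar
    (fun hf ϖ hϖ0 hϖ hp5' hm' Dq L hL Dh hDh =>
      thm1_padicBSD_rankOne_multiplicative.split hD W p hX.2.1 hX.2.2.1 hX.1 hf ϖ hϖ0 hϖ hsplit hp5'
        hm' Dq L hL Dh hDh)
    hX hsplit hp5 hm (hEPW W₁ W p hp5 hgood₁ hord₁ hX.2.2.1 ⟨e, he⟩ hirr₁ h₁) hSch

/-- **THE transport lemma of record (p251763) on a SPLIT cell, with only the split Schneider half:**
N8, `p ≥ 5`, `ρ̄_{E,p}` onto, `E` split at `p` with a second multiplicative prime, a partner `E₁`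
good ordinary at `p` with `E₁[p] ≃ E[p]` and ONE unit coefficient of `ϖ₁ · L_p(f_{E₁}, α)`
(`hcert₁`) ⇒ `BSD(E,p)`, from Emerton–Pollack–Weston Cor. 5.1.4 (`hEPW`), Burungale–Castella–Skinner
2025 Thm. 1.1.2 (b) (`hB`; partner source of any rank, with (im) for `E₁` transported along `hiso`
and Serre's open image `X9.bigIm_of_surj`), Stein–Wuthrich, Disegni Thm. 1, GZK, modularity. This
is the shape of all 50 partner-reachable `¬Ram` N8 cells of the census (all split at `p`).
CONDITIONAL; nothing booked; X11b stays CONSTRUCTION-SHAPED.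
[cite: EmertonPollackWeston2006, Cor. 5.1.4 and Thm. 5.1.3 (arXiv:math/0404484 p. 30)]
[cite: BurungaleCastellaSkinner2025, Thm. 1.1.2 (b) (§1.1, p. 2)] [cite: SteinWuthrich2013, Thm. 6.1, §4.2]
[cite: Disegni2020, Thm. 1 (§1.2), hypothesis (∗)] [cite: Miller2011LMS, Def. 1.1] -/
theorem bsdp_of_goodOrdinaryPartner_of_surj_of_split_of_schneider
    (hEPW : cor514_transfer_of_goodOrdinary) (hB : thm112b_charIdeal_eq_padicLFunction_integral)
    (hJs : thm61_splitMultiplicative) (hHs : exists_isSplitMultCanonical)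
    (hD : thm1_padicBSD_rankOne_multiplicative)
    (hGZK : rank_eq_analyticRank_of_analyticRank_le_one) (hpar : nonempty_modularParametrizationData)
    (W₁ : WeierstrassCurve ℚ) [W₁.IsElliptic] [W₁.IsGloballyMinimal]
    (hp5 : 5 ≤ p) (hX : ClassX11b W p) (hsurj : Surj W p)
    (hsplit : W.HasSplitMultiplicativeReductionAtPrime p)
    (hm : ∃ (m : ℕ) (_ : Fact m.Prime), m ≠ p ∧ W.HasMultiplicativeReductionAtPrime m)
    (hgood₁ : W₁.HasGoodReductionAtPrime p) (hord₁ : ¬ (p : ℤ) ∣ W₁.frobeniusTrace p)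
    (hiso : ∃ e : geomTorsion W₁ (p : ℤ) ≃+ geomTorsion W (p : ℤ),
      ∀ (σ : Field.absoluteGaloisGroup ℚ) (P : geomTorsion W₁ (p : ℤ)), e (σ • P) = σ • e P)
    (hcert₁ : ∀ [NeZero (W₁.conductorNorm ℤ)] (f₁ : CuspForm (Gamma0 (W₁.conductorNorm ℤ)) 2),
        IsNewformOf W₁ f₁ → ∀ (ϖ : ℚ), (ϖ : ℝ) * W₁.realPeriodRat = plusPeriod f₁ →
      ∃ n : ℕ, ‖PowerSeries.coeff n
        (PowerSeries.C (ϖ : ℚ_[p]) * padicLFunction f₁ (unitRoot W₁ p : ℚ_[p]))‖ = 1)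
    (hSch : ∀ (Dq : TateParameterData W p) (Dh : PAdicHeightData W p),
      IsSplitMultCanonical Dh Dq → SchneiderConjecture Dh) : BSDp W p := by
  obtain ⟨e, he⟩ := hiso
  have hirr₁ : W₁.HasIrreducibleModPGaloisRep p :=
    hasIrreducibleModPGaloisRep_of_torsionIso_symm e he hX.2.2.2
  have hsurj₁ : Surj W₁ p :=
    hasSurjectiveModNGaloisRep_of_torsionIso e.symm (torsionIso_symm_smul e he) hsurj
  have him₁ : BigIm W₁ p := X9.bigIm_of_surj W₁ p hp5 hsurj₁
  have h₁ : GoodOrdinaryCharIdealMuZero W₁ p :=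
    goodOrdinaryCharIdealMuZero_of_thm112b hB W₁ p (by omega) ⟨hgood₁, hord₁⟩ hirr₁ him₁ hcert₁
  exact bsdp_of_transfer_goodOrdinary_of_split_of_schneider W p hEPW hJs hHs hD hGZK hpar W₁ hp5 hX
    hsplit hm hgood₁ hord₁ ⟨e, he⟩ h₁ hSch

/-- **The très-ramifié residue theorem (p252284) on a SPLIT cell, with only the split Schneider half:**
N8, `p ≥ 5`, `ρ̄` onto, `E` split at `p` with a second multiplicative prime ⇒ `BSD(E,p)` from the typed
OPEN input `X11a.BaseChangeLowerBoundAt W p`, Kato–Wuthrich A32 (`hKato`), Stein–Wuthrich Thm. 6.1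
split + modified height, Disegni Thm. 1, GZK, modularity (glue `X11a.mazurMainConjectureAt_of_baseChangeLowerBound`
+ `bsdp_of_mazurMainConjectureAt_of_split_of_five_le_of_schneider`). CONDITIONAL on an OPEN input;
nothing booked.
[cite: BurungaleCastellaSkinner2025, "Proof of Theorem 1.1.2" with (5.3)–(5.4) (arXiv:2405.00270v2 p. 10) and Prop. 5.2.1]
[cite: Wuthrich2014, Thm. 3 and Cor. 19 (pp. 383, 398–399)] [cite: SteinWuthrich2013, Thm. 6.1, §4.2]
[cite: Disegni2020, Thm. 1 (§1.2), hypothesis (∗)] [cite: Miller2011LMS, Def. 1.1] -/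
theorem bsdp_of_baseChangeLowerBound_of_split_of_schneider
    (hKato : kato_charIdeal_dvd_multiplicative_of_surjective)
    (hJs : thm61_splitMultiplicative) (hHs : exists_isSplitMultCanonical)
    (hD : thm1_padicBSD_rankOne_multiplicative)
    (hGZK : rank_eq_analyticRank_of_analyticRank_le_one) (hpar : nonempty_modularParametrizationData)
    (hp5 : 5 ≤ p) (hX : ClassX11b W p) (hsurj : Surj W p)
    (hsplit : W.HasSplitMultiplicativeReductionAtPrime p)
    (hm : ∃ (m : ℕ) (_ : Fact m.Prime), m ≠ p ∧ W.HasMultiplicativeReductionAtPrime m)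
    (hBC : X11a.BaseChangeLowerBoundAt W p)
    (hSch : ∀ (Dq : TateParameterData W p) (Dh : PAdicHeightData W p),
      IsSplitMultCanonical Dh Dq → SchneiderConjecture Dh) : BSDp W p :=
  bsdp_of_mazurMainConjectureAt_of_split_of_five_le_of_schneider W p hJs hHs hGZK hpar
    (fun hf ϖ hϖ0 hϖ hp5' hm' Dq L hL Dh hDh =>
      thm1_padicBSD_rankOne_multiplicative.split hD W p hX.2.1 hX.2.2.1 hX.1 hf ϖ hϖ0 hϖ hsplit hp5'
        hm' Dq L hL Dh hDh)
    hX hsplit hp5 hm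
    (X11a.mazurMainConjectureAt_of_baseChangeLowerBound W p hKato hpar hp5 hX.2.2.1 hsurj hBC) hSch

/-- **The très-ramifié residue theorem (p252284) on a NON-SPLIT cell, with only the non-split
Schneider half.** CONDITIONAL on the OPEN input `X11a.BaseChangeLowerBoundAt W p`; nothing booked.
[cite: BurungaleCastellaSkinner2025, "Proof of Theorem 1.1.2" with (5.3)–(5.4) (arXiv:2405.00270v2 p. 10) and Prop. 5.2.1]
[cite: Wuthrich2014, Thm. 3 and Cor. 19 (pp. 383, 398–399)] [cite: SteinWuthrich2013, Thm. 6.1, §4.2]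
[cite: Disegni2020, Thm. 1 (§1.2)] [cite: Miller2011LMS, Def. 1.1] -/
theorem bsdp_of_baseChangeLowerBound_of_not_split_of_schneider
    (hKato : kato_charIdeal_dvd_multiplicative_of_surjective)
    (hJn : thm61_nonsplitMultiplicative) (hHn : exists_isMultCanonical)
    (hD : thm1_padicBSD_rankOne_multiplicative)
    (hGZK : rank_eq_analyticRank_of_analyticRank_le_one) (hpar : nonempty_modularParametrizationData)
    (hp5 : 5 ≤ p) (hX : ClassX11b W p) (hsurj : Surj W p)
    (hns : ¬ W.HasSplitMultiplicativeReductionAtPrime p) (hBC : X11a.BaseChangeLowerBoundAt W p)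
    (hSch : ∀ (q : ℚ_[p]) (Dh : PAdicHeightData W p), q ≠ 0 → ‖q‖ < 1 → tateJ q = (W.j : ℚ_[p]) →
      IsMultCanonical Dh q → SchneiderConjecture Dh) : BSDp W p :=
  bsdp_of_mazurMainConjectureAt_of_nonsplit_of_schneider W p hJn hHn hGZK hpar
    (fun hf ϖ hϖ0 hϖ _q hq0 hq1 hqj L hL Dh hDh =>
      thm1_padicBSD_rankOne_multiplicative.nonsplit hD W p hX.2.1 hX.2.2.1 hX.1 hf ϖ hϖ0 hϖ hns
        hq0 hq1 hqj L hL Dh hDh)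
    hX hns (X11a.mazurMainConjectureAt_of_baseChangeLowerBound W p hKato hpar hp5 hX.2.2.1 hsurj hBC)
    hSch

end SignAware

end ClassClosure

/-! ### §2 ONE REGMULT row (`RegMult.CertSplit` / `RegMult.CertNonsplit`, p251709) as the input C6 -/

namespace RegMult

section Transport

variable (W : WeierstrassCurve ℚ) [W.IsElliptic] [W.IsGloballyMinimal] (p : ℕ) [Fact p.Prime]

/-- **C6 = ONE REGMULT row, SPLIT cell (the 49 C6-TRANSPORT cells of `INSTANCES-t0-C6`):** N8,
`p ≥ 5`, `ρ̄` onto, `E` split at `p` with a second multiplicative prime (C5), a KO-certified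
good-ordinary partner `E₁` (C1, C2 = `hgood₁ hord₁ hiso`), ONE unit coefficient of the partner's
`p`-adic `L`-function (C4 = `hcert₁`) and ONE REGMULT-PAIR/v1 row `RegMult.CertSplit W p P m`
(C6 = `hc`: `m • P` admissible, modified §4.2 height of `m • P` non-zero) ⇒ `BSD(E,p)` from the
published named facts `hEPW hB hJs hHs hD hGZK hpar`. The row discharges exactly the split
Schneider half (`RegMult.schneiderHalf_split_of_cert`, Mordell–Weil rank one from GZK); no (4.1)-row
is needed. CONDITIONAL on the facts; every per-pair input is a finite certificate (EVIDENCE,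
instrumentation tier); nothing booked; X11b stays CONSTRUCTION-SHAPED.
[cite: EmertonPollackWeston2006, Cor. 5.1.4 and Thm. 5.1.3 (arXiv:math/0404484 p. 30)]
[cite: BurungaleCastellaSkinner2025, Thm. 1.1.2 (b) (§1.1, p. 2)]
[cite: SteinWuthrich2013, Thm. 6.1, §4.2 (p. 16)] [cite: Disegni2020, Thm. 1 (§1.2), hypothesis (∗)]
[cite: Miller2011LMS, Def. 1.1] -/
theorem bsdp_of_goodOrdinaryPartner_of_surj_of_certSplit
    (hEPW : cor514_transfer_of_goodOrdinary) (hB : thm112b_charIdeal_eq_padicLFunction_integral)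
    (hJs : thm61_splitMultiplicative) (hHs : exists_isSplitMultCanonical)
    (hD : thm1_padicBSD_rankOne_multiplicative)
    (hGZK : rank_eq_analyticRank_of_analyticRank_le_one) (hpar : nonempty_modularParametrizationData)
    (W₁ : WeierstrassCurve ℚ) [W₁.IsElliptic] [W₁.IsGloballyMinimal]
    (hp5 : 5 ≤ p) (hX : ClassX11b W p) (hsurj : Surj W p)
    (hsplit : W.HasSplitMultiplicativeReductionAtPrime p)
    (hm : ∃ (m : ℕ) (_ : Fact m.Prime), m ≠ p ∧ W.HasMultiplicativeReductionAtPrime m)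
    (hgood₁ : W₁.HasGoodReductionAtPrime p) (hord₁ : ¬ (p : ℤ) ∣ W₁.frobeniusTrace p)
    (hiso : ∃ e : geomTorsion W₁ (p : ℤ) ≃+ geomTorsion W (p : ℤ),
      ∀ (σ : Field.absoluteGaloisGroup ℚ) (P : geomTorsion W₁ (p : ℤ)), e (σ • P) = σ • e P)
    (hcert₁ : ∀ [NeZero (W₁.conductorNorm ℤ)] (f₁ : CuspForm (Gamma0 (W₁.conductorNorm ℤ)) 2),
        IsNewformOf W₁ f₁ → ∀ (ϖ : ℚ), (ϖ : ℝ) * W₁.realPeriodRat = plusPeriod f₁ →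
      ∃ n : ℕ, ‖PowerSeries.coeff n
        (PowerSeries.C (ϖ : ℚ_[p]) * padicLFunction f₁ (unitRoot W₁ p : ℚ_[p]))‖ = 1)
    {P : W.toAffine.Point} {m : ℕ} (hc : CertSplit W p P m) : BSDp W p :=
  ClassClosure.bsdp_of_goodOrdinaryPartner_of_surj_of_split_of_schneider W p hEPW hB hJs hHs hD hGZK
    hpar W₁ hp5 hX hsurj hsplit hm hgood₁ hord₁ hiso hcert₁
    (schneiderHalf_split_of_cert (mordellWeilRank_eq_one_of_analyticRank hGZK hX.1) hc)

/-- **C6 = ONE REGMULT row, NON-SPLIT cell:** the transport lemma of record p251763 itself, its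
bundled input `ClassClosure.RegulatorNonvanishingAt W p` produced from ONE row `RegMult.CertNonsplit W p P m`
by `RegMult.regulatorNonvanishingAt_of_cert_of_not_split` (split half vacuous on a non-split curve).
(No `¬Ram` N8 cell of the census is of this kind — level-lowered partners of the 138 are all at split
cells — but (ram) non-split cells with partners exist; bookkeeping.) CONDITIONAL; nothing booked.
[cite: EmertonPollackWeston2006, Cor. 5.1.4 and Thm. 5.1.3 (arXiv:math/0404484 p. 30)]
[cite: BurungaleCastellaSkinner2025, Thm. 1.1.2 (b) (§1.1, p. 2)]
[cite: SteinWuthrich2013, Thm. 6.1, §4.2 (p. 15)] [cite: Disegni2020, Thm. 1 (§1.2)]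
[cite: Miller2011LMS, Def. 1.1] -/
theorem bsdp_of_goodOrdinaryPartner_of_surj_of_certNonsplit
    (hEPW : cor514_transfer_of_goodOrdinary) (hB : thm112b_charIdeal_eq_padicLFunction_integral)
    (hJn : thm61_nonsplitMultiplicative) (hJs : thm61_splitMultiplicative) (hHn : exists_isMultCanonical)
    (hHs : exists_isSplitMultCanonical) (hD : thm1_padicBSD_rankOne_multiplicative)
    (hGZK : rank_eq_analyticRank_of_analyticRank_le_one) (hpar : nonempty_modularParametrizationData)
    (W₁ : WeierstrassCurve ℚ) [W₁.IsElliptic] [W₁.IsGloballyMinimal]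
    (hp5 : 5 ≤ p) (hX : ClassX11b W p) (hsurj : Surj W p)
    (hns : ¬ W.HasSplitMultiplicativeReductionAtPrime p)
    (hgood₁ : W₁.HasGoodReductionAtPrime p) (hord₁ : ¬ (p : ℤ) ∣ W₁.frobeniusTrace p)
    (hiso : ∃ e : geomTorsion W₁ (p : ℤ) ≃+ geomTorsion W (p : ℤ),
      ∀ (σ : Field.absoluteGaloisGroup ℚ) (P : geomTorsion W₁ (p : ℤ)), e (σ • P) = σ • e P)
    (hcert₁ : ∀ [NeZero (W₁.conductorNorm ℤ)] (f₁ : CuspForm (Gamma0 (W₁.conductorNorm ℤ)) 2),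
        IsNewformOf W₁ f₁ → ∀ (ϖ : ℚ), (ϖ : ℝ) * W₁.realPeriodRat = plusPeriod f₁ →
      ∃ n : ℕ, ‖PowerSeries.coeff n
        (PowerSeries.C (ϖ : ℚ_[p]) * padicLFunction f₁ (unitRoot W₁ p : ℚ_[p]))‖ = 1)
    {P : W.toAffine.Point} {m : ℕ} (hc : CertNonsplit W p P m) : BSDp W p :=
  ClassClosure.bsdp_of_goodOrdinaryPartner_of_surj_of_regulatorNonvanishing W p hEPW hB hJn hJs hHn
    hHs hD hGZK hpar W₁ hp5 hX hsurj (fun hs => absurd hs hns) hgood₁ hord₁ hiso hcert₁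
    (regulatorNonvanishingAt_of_cert_of_not_split (mordellWeilRank_eq_one_of_analyticRank hGZK hX.1)
      hns hc)

/-- **C6 = ONE REGMULT row of the reduction sign's kind (either sign):** `hcs` used iff `E` is split
at `p` (then C5 `hm` is due), `hcn` iff non-split. CONDITIONAL; nothing booked.
[cite: EmertonPollackWeston2006, Cor. 5.1.4 and Thm. 5.1.3 (arXiv:math/0404484 p. 30)]
[cite: BurungaleCastellaSkinner2025, Thm. 1.1.2 (b) (§1.1, p. 2)] [cite: SteinWuthrich2013, Thm. 6.1, §4.2]
[cite: Disegni2020, Thm. 1 (§1.2), hypothesis (∗)] [cite: Miller2011LMS, Def. 1.1] -/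
theorem bsdp_of_goodOrdinaryPartner_of_surj_of_cert
    (hEPW : cor514_transfer_of_goodOrdinary) (hB : thm112b_charIdeal_eq_padicLFunction_integral)
    (hJn : thm61_nonsplitMultiplicative) (hJs : thm61_splitMultiplicative) (hHn : exists_isMultCanonical)
    (hHs : exists_isSplitMultCanonical) (hD : thm1_padicBSD_rankOne_multiplicative)
    (hGZK : rank_eq_analyticRank_of_analyticRank_le_one) (hpar : nonempty_modularParametrizationData)
    (W₁ : WeierstrassCurve ℚ) [W₁.IsElliptic] [W₁.IsGloballyMinimal]
    (hp5 : 5 ≤ p) (hX : ClassX11b W p) (hsurj : Surj W p)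
    (hm : W.HasSplitMultiplicativeReductionAtPrime p →
      ∃ (m : ℕ) (_ : Fact m.Prime), m ≠ p ∧ W.HasMultiplicativeReductionAtPrime m)
    (hgood₁ : W₁.HasGoodReductionAtPrime p) (hord₁ : ¬ (p : ℤ) ∣ W₁.frobeniusTrace p)
    (hiso : ∃ e : geomTorsion W₁ (p : ℤ) ≃+ geomTorsion W (p : ℤ),
      ∀ (σ : Field.absoluteGaloisGroup ℚ) (P : geomTorsion W₁ (p : ℤ)), e (σ • P) = σ • e P)
    (hcert₁ : ∀ [NeZero (W₁.conductorNorm ℤ)] (f₁ : CuspForm (Gamma0 (W₁.conductorNorm ℤ)) 2),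
        IsNewformOf W₁ f₁ → ∀ (ϖ : ℚ), (ϖ : ℝ) * W₁.realPeriodRat = plusPeriod f₁ →
      ∃ n : ℕ, ‖PowerSeries.coeff n
        (PowerSeries.C (ϖ : ℚ_[p]) * padicLFunction f₁ (unitRoot W₁ p : ℚ_[p]))‖ = 1)
    {P : W.toAffine.Point} {m : ℕ}
    (hcn : ¬ W.HasSplitMultiplicativeReductionAtPrime p → CertNonsplit W p P m)
    (hcs : W.HasSplitMultiplicativeReductionAtPrime p → CertSplit W p P m) : BSDp W p := by
  by_cases hsplit : W.HasSplitMultiplicativeReductionAtPrime p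
  · exact bsdp_of_goodOrdinaryPartner_of_surj_of_certSplit W p hEPW hB hJs hHs hD hGZK hpar W₁ hp5 hX
      hsurj hsplit (hm hsplit) hgood₁ hord₁ hiso hcert₁ (hcs hsplit)
  · exact bsdp_of_goodOrdinaryPartner_of_surj_of_certNonsplit W p hEPW hB hJn hJs hHn hHs hD hGZK hpar
      W₁ hp5 hX hsurj hsplit hgood₁ hord₁ hiso hcert₁ (hcn hsplit)

/-- **C6 = ONE REGMULT row, SPLIT cell, partner identity supplied otherwise** (the C6-CM-PARTNER cell
`84960d1@5` of `INSTANCES-t0-C6`: image `5Ns`, so Burungale–Castella–Skinner (b) is unavailable and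
`h₁ : GoodOrdinaryCharIdealMuZero W₁ p` comes from another source, e.g. the Rubin ∘ Greenberg–Vatsal
CM route for the partner `288a`; also rank-`0` partners via the X9 seat's sources). CONDITIONAL;
nothing booked. [cite: EmertonPollackWeston2006, Cor. 5.1.4 and Thm. 5.1.3 (arXiv:math/0404484 p. 30)]
[cite: SteinWuthrich2013, Thm. 6.1, §4.2 (p. 16)] [cite: Disegni2020, Thm. 1 (§1.2), hypothesis (∗)]
[cite: Miller2011LMS, Def. 1.1] -/
theorem bsdp_of_transfer_goodOrdinary_of_certSplit
    (hEPW : cor514_transfer_of_goodOrdinary) (hJs : thm61_splitMultiplicative)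
    (hHs : exists_isSplitMultCanonical) (hD : thm1_padicBSD_rankOne_multiplicative)
    (hGZK : rank_eq_analyticRank_of_analyticRank_le_one) (hpar : nonempty_modularParametrizationData)
    (W₁ : WeierstrassCurve ℚ) [W₁.IsElliptic] [W₁.IsGloballyMinimal]
    (hp5 : 5 ≤ p) (hX : ClassX11b W p) (hsplit : W.HasSplitMultiplicativeReductionAtPrime p)
    (hm : ∃ (m : ℕ) (_ : Fact m.Prime), m ≠ p ∧ W.HasMultiplicativeReductionAtPrime m)
    (hgood₁ : W₁.HasGoodReductionAtPrime p) (hord₁ : ¬ (p : ℤ) ∣ W₁.frobeniusTrace p)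
    (hiso : ∃ e : geomTorsion W₁ (p : ℤ) ≃+ geomTorsion W (p : ℤ),
      ∀ (σ : Field.absoluteGaloisGroup ℚ) (P : geomTorsion W₁ (p : ℤ)), e (σ • P) = σ • e P)
    (h₁ : GoodOrdinaryCharIdealMuZero W₁ p)
    {P : W.toAffine.Point} {m : ℕ} (hc : CertSplit W p P m) : BSDp W p :=
  ClassClosure.bsdp_of_transfer_goodOrdinary_of_split_of_schneider W p hEPW hJs hHs hD hGZK hpar W₁ hp5
    hX hsplit hm hgood₁ hord₁ hiso h₁
    (schneiderHalf_split_of_cert (mordellWeilRank_eq_one_of_analyticRank hGZK hX.1) hc)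

/-- **The 7 peu-ramifié-without-rational-partner cells' typed target, with ONE REGMULT row:**
Mazur's main conjecture at the pair (`hMC : X2.MazurMainConjectureAt W p`, typed OPEN input; no (ram),
no `μ`) + the published facts + ONE row of the sign's kind ⇒ `BSD(E,p)` (p252284's
`bsdp_of_mazurMainConjectureAt_of_{split_of_five_le,nonsplit}_of_schneider` with the row's half).
CONDITIONAL on an OPEN input; nothing booked.
[cite: Skinner2016PacificMC, Thm. A (§1) with §3.2–3.3 (shape only)] [cite: SteinWuthrich2013, Thm. 6.1, §4.2]
[cite: Disegni2020, Thm. 1 (§1.2), hypothesis (∗)] [cite: Miller2011LMS, Def. 1.1] -/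
theorem bsdp_of_mazurMainConjectureAt_of_cert (hJn : thm61_nonsplitMultiplicative)
    (hJs : thm61_splitMultiplicative) (hHn : exists_isMultCanonical) (hHs : exists_isSplitMultCanonical)
    (hD : thm1_padicBSD_rankOne_multiplicative)
    (hGZK : rank_eq_analyticRank_of_analyticRank_le_one) (hpar : nonempty_modularParametrizationData)
    (hX : ClassX11b W p)
    (hcorner : W.HasSplitMultiplicativeReductionAtPrime p →
      5 ≤ p ∧ ∃ (m : ℕ) (_ : Fact m.Prime), m ≠ p ∧ W.HasMultiplicativeReductionAtPrime m)
    (hMC : X2.MazurMainConjectureAt W p) {P : W.toAffine.Point} {m : ℕ}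
    (hcn : ¬ W.HasSplitMultiplicativeReductionAtPrime p → CertNonsplit W p P m)
    (hcs : W.HasSplitMultiplicativeReductionAtPrime p → CertSplit W p P m) : BSDp W p := by
  have hr : W.mordellWeilRank = 1 := mordellWeilRank_eq_one_of_analyticRank hGZK hX.1
  by_cases hsplit : W.HasSplitMultiplicativeReductionAtPrime p
  · obtain ⟨hp5, hm⟩ := hcorner hsplit
    exact ClassClosure.bsdp_of_mazurMainConjectureAt_of_split_of_five_le_of_schneider W p hJs hHs hGZK
      hpar
      (fun hf ϖ hϖ0 hϖ hp5' hm' Dq L hL Dh hDh =>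
        thm1_padicBSD_rankOne_multiplicative.split hD W p hX.2.1 hX.2.2.1 hX.1 hf ϖ hϖ0 hϖ hsplit hp5'
          hm' Dq L hL Dh hDh)
      hX hsplit hp5 hm hMC (schneiderHalf_split_of_cert hr (hcs hsplit))
  · exact ClassClosure.bsdp_of_mazurMainConjectureAt_of_nonsplit_of_schneider W p hJn hHn hGZK hpar
      (fun hf ϖ hϖ0 hϖ _q hq0 hq1 hqj L hL Dh hDh =>
        thm1_padicBSD_rankOne_multiplicative.nonsplit hD W p hX.2.1 hX.2.2.1 hX.1 hf ϖ hϖ0 hϖ hsplit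
          hq0 hq1 hqj L hL Dh hDh)
      hX hsplit hMC (schneiderHalf_nonsplit_of_cert hr (hcn hsplit))

/-- **The 81 très-ramifié cells' typed OPEN target, with ONE REGMULT row:** N8, `p ≥ 5`, `ρ̄` onto ⇒
`BSD(E,p)` from `X11a.BaseChangeLowerBoundAt W p` (OPEN), Kato–Wuthrich A32, Stein–Wuthrich, Disegni
Thm. 1, GZK, modularity, a second multiplicative prime at a split `p`, and ONE row of the sign's kind
(43 non-split + 38 split cells in the census tranche). CONDITIONAL on an OPEN input; nothing booked.
[cite: BurungaleCastellaSkinner2025, "Proof of Theorem 1.1.2" with (5.3)–(5.4) (arXiv:2405.00270v2 p. 10) and Prop. 5.2.1]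
[cite: Wuthrich2014, Thm. 3 and Cor. 19 (pp. 383, 398–399)] [cite: SteinWuthrich2013, Thm. 6.1, §4.2]
[cite: Disegni2020, Thm. 1 (§1.2), hypothesis (∗)] [cite: Miller2011LMS, Def. 1.1] -/
theorem bsdp_of_baseChangeLowerBound_of_cert (hKato : kato_charIdeal_dvd_multiplicative_of_surjective)
    (hJn : thm61_nonsplitMultiplicative) (hJs : thm61_splitMultiplicative)
    (hHn : exists_isMultCanonical) (hHs : exists_isSplitMultCanonical)
    (hD : thm1_padicBSD_rankOne_multiplicative)
    (hGZK : rank_eq_analyticRank_of_analyticRank_le_one) (hpar : nonempty_modularParametrizationData)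
    (hp5 : 5 ≤ p) (hX : ClassX11b W p) (hsurj : Surj W p)
    (hm : W.HasSplitMultiplicativeReductionAtPrime p →
      ∃ (m : ℕ) (_ : Fact m.Prime), m ≠ p ∧ W.HasMultiplicativeReductionAtPrime m)
    (hBC : X11a.BaseChangeLowerBoundAt W p) {P : W.toAffine.Point} {m : ℕ}
    (hcn : ¬ W.HasSplitMultiplicativeReductionAtPrime p → CertNonsplit W p P m)
    (hcs : W.HasSplitMultiplicativeReductionAtPrime p → CertSplit W p P m) : BSDp W p := by
  have hr : W.mordellWeilRank = 1 := mordellWeilRank_eq_one_of_analyticRank hGZK hX.1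
  by_cases hsplit : W.HasSplitMultiplicativeReductionAtPrime p
  · exact ClassClosure.bsdp_of_baseChangeLowerBound_of_split_of_schneider W p hKato hJs hHs hD hGZK hpar
      hp5 hX hsurj hsplit (hm hsplit) hBC (schneiderHalf_split_of_cert hr (hcs hsplit))
  · exact ClassClosure.bsdp_of_baseChangeLowerBound_of_not_split_of_schneider W p hKato hJn hHn hD hGZK
      hpar hp5 hX hsurj hsplit hBC (schneiderHalf_nonsplit_of_cert hr (hcn hsplit))

end Transport

end RegMult

end Summit.BirchSwinnertonDyer.Rank1Residual.X11b

end
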